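import Summits.NavierStokesRegularity.NavierStokesRegularity.Theorems.PerpetualPumpAveragedTypeIBlowupPulseBootRegime
import Summits.NavierStokesRegularity.NavierStokesRegularity.Theorems.PerpetualPumpAveragedTypeIBlowupHandoffSlow
import Summits.NavierStokesRegularity.NavierStokesRegularity.Theorems.PerpetualPumpAveragedTypeIBlowupPreBootRegime
import Summits.NavierStokesRegularity.NavierStokesRegularity.Theorems.PerpetualPumpAveragedTypeIBlowupLevelOneBond

/-!
# Crux `PerpetualPump.AveragedTypeIBlowup` (stmt-NavierStokesRegularity-1835), line `Sketch`:
# stub `pulseBoot` — the level-1 pair during the truncated pulse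

Third file of the proof of the registered stub `stub_pulseBoot`. The next bond during the pulse
obeys the landed `stub_levelOneBond` in the front clock (rate `q⁴`, carrier size `B_β = B' + 1`,
carrier budget `Λ = 5 log B' + 21`), and the amplification factor `e^{q⁵Λ} ≤ e^{25} B'^6` is only
polynomial (`pulseBoot_amplification`, = registered tools sub-goal `stub_pulseBootLevel`), so the
bond stays below `Y₁ = e^{25} ε̄ (b_hi+4)⁸` and its majorant below `1`; the next carrier's
majorant is bounded by its Duhamel restart inequality fed by the transfer budget
(`pulseBoot_levelOne`).

## References

T. Tao, *Finite time blowup for an averaged three-dimensional Navier–Stokes equation*, J. Amer.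
Math. Soc. 29 (2016), 601–674, §5–6 (the cascade / transfer-pulse heuristics); the content here is
folklore ODE calculus (comparison, Duhamel bounds, continuous induction).
-/

noncomputable section

-- the summit namespace `…NavierStokesRegularity.NavierStokesRegularity…` is the tree convention
set_option linter.dupNamespace false

open Set MeasureTheory Filter Topology

namespace Summit.NavierStokesRegularity.NavierStokesRegularity.Theorems.PerpetualPumpAveragedTypeIBlowup

/-- **The amplification factor of the next bond over a truncated pulse is polynomial**: with
`Λ = 5 log B' + 21` (`B' ≥ 10⁴`) and `q⁵ ≤ 116/100`, `e^{q⁵Λ} ≤ e^{25} B'^6`; and the seed it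
amplifies is `≤ 0.35 ε̄ B_β²` (`B_β = B' + 1`, `σ ≤ 1/10`, `q² ≤ 111/100`), so the bond is
`≤ 0.35 e^{25} ε̄ B_β^8`. [folklore] -/
theorem pulseBoot_amplification {q εb Bp σ y0 : ℝ} (hB' : 10 ^ 4 ≤ Bp) (hq5 : q ^ 5 ≤ 116 / 100)
    (hq0 : 0 < q) (hq2 : q ^ 2 ≤ 111 / 100) (hεb : 0 < εb) (hσ0 : 0 ≤ σ) (hσ : σ ≤ 1 / 10)
    (hy0 : 0 ≤ y0) (hy0' : y0 ≤ 11 / 10 * εb) :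
    Real.exp (q ^ 5 * (5 * Real.log Bp + 21)) * (y0 + 3 * εb * q ^ 2 * (Bp + 1) ^ 2 * σ) ≤
      35 / 100 * Real.exp 25 * εb * (Bp + 1) ^ 8 := by
  have hB'0 : 0 < Bp := by linarith
  have hlog0 : 0 ≤ Real.log Bp := Real.log_nonneg (by linarith)
  have hq50 : 0 ≤ q ^ 5 := by positivity
  have h1 : q ^ 5 * (5 * Real.log Bp + 21) ≤ (6 : ℕ) * Real.log Bp + 25 := by
    have := mul_le_mul_of_nonneg_right hq5 (by linarith : 0 ≤ 5 * Real.log Bp + 21)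
    push_cast
    nlinarith
  have h2 : Real.exp (q ^ 5 * (5 * Real.log Bp + 21)) ≤ Bp ^ 6 * Real.exp 25 := by
    refine (Real.exp_le_exp.2 h1).trans ?_
    rw [Real.exp_add, Real.exp_nat_mul, Real.exp_log hB'0]
  have h3 : y0 + 3 * εb * q ^ 2 * (Bp + 1) ^ 2 * σ ≤ 35 / 100 * εb * (Bp + 1) ^ 2 := by
    have hB2 : 10 ^ 8 ≤ (Bp + 1) ^ 2 := by nlinarith
    have h31 : 3 * εb * q ^ 2 * (Bp + 1) ^ 2 * σ ≤ 3 * εb * (111 / 100) * (Bp + 1) ^ 2 * (1 / 10) := by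
      have a : 3 * εb * q ^ 2 ≤ 3 * εb * (111 / 100) := by nlinarith
      have b : 3 * εb * q ^ 2 * (Bp + 1) ^ 2 ≤ 3 * εb * (111 / 100) * (Bp + 1) ^ 2 :=
        mul_le_mul_of_nonneg_right a (by positivity)
      exact mul_le_mul b hσ hσ0 (by positivity)
    have h32 : (11 : ℝ) / 10 ≤ 17 / 1000 * (Bp + 1) ^ 2 := by linarith
    nlinarith
  have h4 : Bp ^ 6 ≤ (Bp + 1) ^ 6 := pow_le_pow_left₀ hB'0.le (by linarith) 6
  have h5 : 0 ≤ y0 + 3 * εb * q ^ 2 * (Bp + 1) ^ 2 * σ := by positivity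
  calc Real.exp (q ^ 5 * (5 * Real.log Bp + 21)) * (y0 + 3 * εb * q ^ 2 * (Bp + 1) ^ 2 * σ)
      ≤ (Bp ^ 6 * Real.exp 25) * (35 / 100 * εb * (Bp + 1) ^ 2) :=
        mul_le_mul h2 h3 h5 (by positivity)
    _ ≤ ((Bp + 1) ^ 6 * Real.exp 25) * (35 / 100 * εb * (Bp + 1) ^ 2) :=
        mul_le_mul_of_nonneg_right (mul_le_mul_of_nonneg_right h4 (Real.exp_pos _).le)
          (by positivity)
    _ = 35 / 100 * Real.exp 25 * εb * (Bp + 1) ^ 8 := by ring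

set_option maxHeartbeats 1600000 in
/-- **The level-1 pair on a truncated pulse horizon.** On `[tι, S]` (as in `pulseBoot_front`):
from the TIGHT front (`b_{n+1} ∈ [−q/50, q(B' + 1/100)]`, transfer budget
`R_n ∫_{tι}^s w_n² ≤ B' + 6 log B' + 23`), the loose rung above (`|b_{n+2}| ≤ 1/2`) and the loose
level-1 pair itself (`|w_{n+1}| ≤ 1/100`, `|b_{n+1}| ≤ 3(b_hi+4)`), and the pre-charge at ignition
(`|w_{n+1}(tι)| ≤ 1.1 ε̄`, `M1 (n+1) (tι) ≤ 4ε̄`, `M0 (n+1) (tι) ≤ ε̄ + (B+3)/40`): the next bond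
obeys `stub_levelOneBond` in the front clock (rate `q⁴`, `B_β = B' + 1`, `Λ = 5 log B' + 21`,
`y₀ = 1.1 ε̄`), hence `|w_{n+1}| ≤ Y₁ = e^{25} ε̄ (b_hi+4)⁸` and `M1 (n+1) ≤ 1`; and the Duhamel
restart inequality of the next carrier's majorant, fed by the transfer budget, gives
`M0 (n+1) ≤ 3B/2`. [folklore] -/
theorem pulseBoot_levelOne {ε₀ D εb θ η F blo bhi q T t₀ tι S B : ℝ} {n : ℤ}
    {bv wv M0 M1 db dw G0 G1 : ℤ → ℝ → ℝ} {R : ℤ → ℝ}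
    (hq : q = Real.sqrt (1 + ε₀)) (hR : ∀ k : ℤ, R k = D * (1 + ε₀) ^ (2 * k))
    (hG0 : ∀ (k : ℤ) (t : ℝ), G0 k t = (wv (k - 1) t) ^ 2 / q ^ 3 - (wv k t) ^ 2 - εb * bv k t * wv k t)
    (hG1 : ∀ (k : ℤ) (t : ℝ), G1 k t = wv k t * (bv k t - bv (k + 1) t / q) + εb * (bv k t) ^ 2)
    (hε₀ : 0 < ε₀) (hε₀' : ε₀ ≤ 1 / 20) (hD : 0 < D) (hθ : 1 / 2 ≤ θ) (hθ1 : θ ≤ 1) (hη : 0 ≤ η)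
    (hεb : 0 < εb) (hεb6 : εb ≤ 1 / 10 ^ 6) (hblo : 10 ^ 4 + 40 - 5 * Real.log εb ≤ blo)
    (hF : 10 ^ 9 * (bhi + 4) ^ 4 ≤ F) (hηreg : η * (10 ^ 9 * (bhi + 4) ^ 4 * (F + 1)) ≤ 1)
    (hεbreg : εb * (10 ^ 9 * (F + 1) ^ 2 * (bhi + 4) ^ 3) ≤ 1)
    (hseed : 10 ^ 3 + 20 * Real.log (bhi + 5) + Real.log (F + 2) ≤ -Real.log εb)
    (hBlo : blo ≤ B) (hBhi : B ≤ bhi)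
    (hcont : ∀ k : ℤ, ContinuousOn (bv k) (Icc 0 T) ∧ ContinuousOn (wv k) (Icc 0 T) ∧
      ContinuousOn (M0 k) (Icc 0 T) ∧ ContinuousOn (M1 k) (Icc 0 T))
    (hC1 : ∀ k : ℤ, ContinuousOn (db k) (Icc 0 T) ∧ ContinuousOn (dw k) (Icc 0 T) ∧
      ∀ t ∈ Ioo 0 T, HasDerivAt (bv k) (db k t) t ∧
        |db k t - R k * (-(bv k t) + G0 k t)| ≤ η * R k * M0 k t ∧
        HasDerivAt (wv k) (dw k t) t ∧ |dw k t - R k * (-(wv k t) + G1 k t)| ≤ η * R k * M1 k t)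
    (hmaj : ∀ k : ℤ, ∀ t ∈ Icc 0 T, |bv k t| ≤ M0 k t ∧ |wv k t| ≤ M1 k t ∧ 0 ≤ M0 k t ∧ 0 ≤ M1 k t)
    (hrest : ∀ k : ℤ, ∀ t₁ ∈ Icc 0 T, ∀ t₂ ∈ Icc t₁ T,
      M0 k t₂ ≤ M0 k t₁ * Real.exp (-(θ * R k * (t₂ - t₁))) +
          R k * ∫ u in t₁..t₂, Real.exp (-(θ * R k * (t₂ - u))) * |G0 k u| ∧
        M1 k t₂ ≤ M1 k t₁ * Real.exp (-(θ * R k * (t₂ - t₁))) +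
          R k * ∫ u in t₁..t₂, Real.exp (-(θ * R k * (t₂ - u))) * |G1 k u|)
    (hT : 0 < T) (ht₀ : 0 ≤ t₀) (htι : t₀ < tι) (hS : tι ≤ S) (hST : S ≤ T)
    (hSP : S ≤ tι + (5 * Real.log (bv n tι) + 20) / bv n tι / R n)
    (hB' : 10 ^ 4 ≤ bv n tι) (hB'B : bv n tι ≤ B + 5 / 2)
    (hw1ι : |wv (n + 1) tι| ≤ 11 / 10 * εb) (hM1ι : M1 (n + 1) tι ≤ 4 * εb)
    (hM0ι : M0 (n + 1) tι ≤ εb + (B + 3) / 40)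
    (hFr : ∀ u ∈ Icc tι S, -(q / 50) ≤ bv (n + 1) u ∧ bv (n + 1) u ≤ q * (bv n tι + 1 / 100) ∧
      R n * ∫ t in tι..u, (wv n t) ^ 2 ≤ bv n tι + 6 * Real.log (bv n tι) + 23)
    (hL : ∀ u ∈ Icc tι S, |bv (n + 2) u| ≤ 1 / 2 ∧ |wv (n + 1) u| ≤ 1 / 100 ∧
      |bv (n + 1) u| ≤ 3 * (bhi + 4)) :
    ∀ u ∈ Icc tι S, |wv (n + 1) u| ≤ Real.exp 25 * εb * (bhi + 4) ^ 8 ∧ M1 (n + 1) u ≤ 1 ∧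
      M0 (n + 1) u ≤ 3 / 2 * B := by
  obtain ⟨hεb1, hB4, hB1, hF0, -, -, hq1, hq21⟩ :=
    oneStepCore_regime hε₀ hε₀' hεb hεb6 hblo hF hεbreg hBlo hBhi hq
  have hbhi : 1 ≤ bhi + 4 := by linarith
  obtain ⟨-, hεb2, hq4lo, hq4hi, hq3lo, hq3hi, hq5, hq0, -, -⟩ :=
    pulseBoot_sizes hε₀ hε₀' hεb hF0 hbhi hεbreg hq
  obtain ⟨hRpos, -, -, hκ4, -, -, -, -, -, -, hq2⟩ := preBoot_rates hε₀ hε₀' hD hR hq n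
  have hRn := hRpos n
  have hθ0 : 0 < θ := by linarith
  obtain ⟨hη9, hη1, -, hη4, -⟩ := preBoot_eta hη hF0 hbhi hηreg
  obtain ⟨hY0, hY2, hY3, -, -, hY5⟩ := pulseBoot_Y hεb hF0 hbhi hseed
  set Y₁ := Real.exp 25 * εb * (bhi + 4) ^ 8 with hY₁
  set B' := bv n tι with hB'def
  have hB'0 : 0 < B' := by linarith
  -- slow time of the front from the ignition time
  set S' := R n * (S - tι) with hS'
  have hS'0 : 0 ≤ S' := mul_nonneg hRn.le (by linarith)
  obtain ⟨hlog0, hlogB, hσP0, hσP⟩ := pulseBoot_sigmaP hB'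
  have hS'P : S' ≤ (5 * Real.log B' + 20) / B' := by
    have h1 : S - tι ≤ (5 * Real.log B' + 20) / B' / R n := by linarith
    calc S' = R n * (S - tι) := rfl
      _ ≤ R n * ((5 * Real.log B' + 20) / B' / R n) := mul_le_mul_of_nonneg_left h1 hRn.le
      _ = (5 * Real.log B' + 20) / B' := mul_div_cancel₀ _ hRn.ne'
  have hS'le : S' ≤ 1 / 10 := hS'P.trans hσP
  have hST' : tι + S' / R n ≤ T := by
    rw [hS', mul_div_cancel_left₀ _ hRn.ne']
    linarith
  have htι0 : 0 ≤ tι := by linarith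
  obtain ⟨⟨hb1c, hm01c, hg01c, -, -, -, hm01D⟩, ⟨hw1c, hm11c, -, he11c, hdw1, he11, hm11D⟩⟩ :=
    handoff_sysPkg (k := n + 1) hG0 hG1 hcont hC1 hmaj hrest hRn hT htι0 hS'0 hST'
  obtain ⟨-, ⟨hwc, -⟩⟩ :=
    handoff_sysPkg (k := n) hG0 hG1 hcont hC1 hmaj hrest hRn hT htι0 hS'0 hST'
  obtain ⟨⟨hb2c, -⟩, -⟩ :=
    handoff_sysPkg (k := n + 2) hG0 hG1 hcont hC1 hmaj hrest hRn hT htι0 hS'0 hST'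
  -- clock algebra of the slow time from `tι`
  have hmem : ∀ σ ∈ Icc 0 S', tι + σ / R n ∈ Icc tι S := by
    intro σ hσ
    have h0 : 0 ≤ σ / R n := div_nonneg hσ.1 hRn.le
    have h1 : σ / R n ≤ S' / R n := div_le_div_of_nonneg_right hσ.2 hRn.le
    rw [hS', mul_div_cancel_left₀ _ hRn.ne'] at h1
    exact ⟨by linarith, by linarith⟩
  have htime1 : ∀ s : ℝ, tι + R n * (s - tι) / R n = s := fun s => by field_simp; ring
  have htime : ∀ σ : ℝ, R n * ((tι + σ / R n) - tι) = σ := fun σ => by field_simp; ring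
  have ht00 : tι + 0 / R n = tι := by simp
  have hn1 : n + 1 - 1 = n := by ring
  have hn2 : n + 1 + 1 = n + 2 := by ring
  have hqb : ∀ x : ℝ, q * (x / q) = x := fun x => mul_div_cancel₀ x hq0.ne'
  have hqb2 : ∀ x : ℝ, εb * q ^ 2 * (x / q) ^ 2 = εb * x ^ 2 := fun x => by
    field_simp
  -- the bounds in slow time
  have hLσ : ∀ σ ∈ Icc 0 S', |bv (n + 2) (tι + σ / R n)| ≤ 1 / 2 ∧
      |wv (n + 1) (tι + σ / R n)| ≤ 1 / 100 ∧ |bv (n + 1) (tι + σ / R n)| ≤ 3 * (bhi + 4) :=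
    fun σ hσ => hL _ (hmem σ hσ)
  have hβσ : ∀ σ ∈ Icc 0 S', -(1 / 50) ≤ bv (n + 1) (tι + σ / R n) / q ∧
      bv (n + 1) (tι + σ / R n) / q ≤ B' + 1 / 100 ∧ |bv (n + 1) (tι + σ / R n) / q| ≤ B' + 1 / 50 := by
    intro σ hσ
    obtain ⟨f1, f2, -⟩ := hFr _ (hmem σ hσ)
    have a : -(1 / 50) ≤ bv (n + 1) (tι + σ / R n) / q := by
      rw [le_div_iff₀ hq0]
      linarith
    have b : bv (n + 1) (tι + σ / R n) / q ≤ B' + 1 / 100 := by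
      rw [div_le_iff₀ hq0]
      linarith
    exact ⟨a, b, abs_le.2 ⟨by linarith, by linarith⟩⟩
  have hbudσ : ∀ σ ∈ Icc 0 S', ∫ v in (0 : ℝ)..σ, (wv n (tι + v / R n)) ^ 2 ≤
      B' + 6 * Real.log B' + 23 := by
    intro σ hσ
    obtain ⟨-, -, f3⟩ := hFr _ (hmem σ hσ)
    have e1 : ∫ v in (0 : ℝ)..σ, (wv n (tι + v / R n)) ^ 2 =
        R n * ∫ t in tι..(tι + σ / R n), (wv n t) ^ 2 := by
      rw [← integral_rescale (fun t => (wv n t) ^ 2) hRn.ne' 0 σ,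
        intervalIntegral.integral_const_mul, ht00]
    rw [e1]
    exact f3
  -- hypotheses of `stub_levelOneBond`
  have h1 : ∀ σ ∈ Ioo 0 S', HasDerivAt (fun s => wv (n + 1) (tι + s / R n))
      (q ^ 4 * (wv (n + 1) (tι + σ / R n) *
          (q * (bv (n + 1) (tι + σ / R n) / q) - bv (n + 2) (tι + σ / R n) / q - 1) +
        εb * q ^ 2 * (bv (n + 1) (tι + σ / R n) / q) ^ 2) +
        (dw (n + 1) (tι + σ / R n) -
          R (n + 1) * (-(wv (n + 1) (tι + σ / R n)) + G1 (n + 1) (tι + σ / R n))) / R n) σ := by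
    intro σ hσ
    refine (hdw1 σ hσ).congr_deriv ?_
    rw [hκ4, hG1, hn2, hqb, hqb2]
    ring
  have h2 : ∀ σ ∈ Icc 0 S', |(dw (n + 1) (tι + σ / R n) -
      R (n + 1) * (-(wv (n + 1) (tι + σ / R n)) + G1 (n + 1) (tι + σ / R n))) / R n| ≤
        η * q ^ 4 * M1 (n + 1) (tι + σ / R n) := by
    intro σ hσ
    have := he11 σ hσ
    rwa [hκ4] at this
  have h3 : ∀ σ ∈ Icc 0 S', 0 ≤ M1 (n + 1) (tι + σ / R n) ∧
      M1 (n + 1) (tι + σ / R n) ≤ M1 (n + 1) (tι + 0 / R n) * Real.exp (-(θ * q ^ 4 * σ)) +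
        q ^ 4 * ∫ u in (0 : ℝ)..σ, Real.exp (-(θ * q ^ 4 * (σ - u))) *
          |wv (n + 1) (tι + u / R n) * (q * (bv (n + 1) (tι + u / R n) / q) -
              bv (n + 2) (tι + u / R n) / q) +
            εb * q ^ 2 * (bv (n + 1) (tι + u / R n) / q) ^ 2| := by
    intro σ hσ
    have h := hm11D σ hσ
    simp only [hκ4, hG1, hn2] at h
    simp only [hqb, hqb2]
    exact h
  have h4 : ∀ σ ∈ Icc 0 S', -(1 / 50) ≤ bv (n + 1) (tι + σ / R n) / q ∧
      bv (n + 1) (tι + σ / R n) / q ≤ B' + 1 := fun σ hσ =>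
    ⟨(hβσ σ hσ).1, by linarith [(hβσ σ hσ).2.1]⟩
  have h5 : ∀ σ ∈ Icc 0 S', ∫ u in (0 : ℝ)..σ, |bv (n + 1) (tι + u / R n) / q| ≤
      5 * Real.log B' + 21 := by
    intro σ hσ
    have hsub : Icc 0 σ ⊆ Icc 0 S' := Icc_subset_Icc_right hσ.2
    have hint : ∫ u in (0 : ℝ)..σ, |bv (n + 1) (tι + u / R n) / q| ≤ ∫ _ in (0 : ℝ)..σ, (B' + 1 / 50) :=
      intervalIntegral.integral_mono_on hσ.1
        ((continuous_abs.comp_continuousOn ((hb1c.div_const q).mono hsub)).intervalIntegrable_of_Icc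
          (μ := volume) hσ.1)
        intervalIntegrable_const (fun u hu => (hβσ u (hsub hu)).2.2)
    rw [intervalIntegral.integral_const, smul_eq_mul, sub_zero] at hint
    have hσB : σ * (B' + 1 / 50) ≤ (5 * Real.log B' + 20) / B' * (B' + 1 / 50) :=
      mul_le_mul_of_nonneg_right (hσ.2.trans hS'P) (by linarith)
    have e : (5 * Real.log B' + 20) / B' * (B' + 1 / 50) =
        (5 * Real.log B' + 20) + (5 * Real.log B' + 20) / B' * (1 / 50) := by
      field_simp
    rw [e] at hσB
    have : (5 * Real.log B' + 20) / B' * (1 / 50) ≤ 1 / 10 * (1 / 50) :=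
      mul_le_mul_of_nonneg_right hσP (by norm_num)
    linarith
  have hBβ : (10 : ℝ) ^ 4 ≤ B' + 1 := by linarith
  have hBβ4 : B' + 1 ≤ bhi + 4 := by linarith
  have hq2le : q ^ 2 ≤ 111 / 100 := by rw [hq2]; linarith
  have hBβ2 : (B' + 1) ^ 2 ≤ (bhi + 4) ^ 2 := pow_le_pow_left₀ (by linarith) hBβ4 2
  have hεBβ' : εb * q ^ 2 * (B' + 1) ^ 2 ≤ 2 / 10 ^ 9 := by
    have h2 : εb * q ^ 2 * (B' + 1) ^ 2 ≤ εb * (111 / 100) * (bhi + 4) ^ 2 :=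
      mul_le_mul (mul_le_mul_of_nonneg_left hq2le hεb.le) hBβ2 (by positivity) (by positivity)
    have e : εb * (111 / 100) * (bhi + 4) ^ 2 = 111 / 100 * (εb * (bhi + 4) ^ 2) := by ring
    linarith
  have hεBβ : εb * q ^ 2 * (B' + 1) ^ 2 ≤ 1 := hεBβ'.trans (by norm_num)
  have hηBβ : η * (q * (B' + 1) + 1) ^ 3 ≤ 1 / 10 ^ 6 := by
    have h1 : q * (B' + 1) + 1 ≤ 12 / 10 * (bhi + 4) := by
      have : q * (B' + 1) ≤ 21 / 20 * (B' + 1) := mul_le_mul_of_nonneg_right hq21 (by linarith)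
      linarith
    have h2 : (q * (B' + 1) + 1) ^ 3 ≤ (12 / 10 * (bhi + 4)) ^ 3 :=
      pow_le_pow_left₀ (by positivity) h1 3
    have h3 : η * (q * (B' + 1) + 1) ^ 3 ≤ η * (12 / 10 * (bhi + 4)) ^ 3 :=
      mul_le_mul_of_nonneg_left h2 hη
    have h4 : η * (bhi + 4) ^ 3 ≤ 1 / 10 ^ 9 := by
      have : η * (bhi + 4) ^ 3 ≤ η * (bhi + 4) ^ 4 :=
        mul_le_mul_of_nonneg_left (pow_le_pow_right₀ hbhi (by norm_num)) hη
      linarith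
    have e : η * (12 / 10 * (bhi + 4)) ^ 3 = 1728 / 1000 * (η * (bhi + 4) ^ 3) := by ring
    linarith
  have key := stub_levelOneBond (fun s => wv (n + 1) (tι + s / R n))
    (fun s => bv (n + 1) (tι + s / R n) / q) (fun s => bv (n + 2) (tι + s / R n))
    (fun s => M1 (n + 1) (tι + s / R n))
    (fun σ => (dw (n + 1) (tι + σ / R n) -
      R (n + 1) * (-(wv (n + 1) (tι + σ / R n)) + G1 (n + 1) (tι + σ / R n))) / R n)
    q θ η εb (B' + 1) (5 * Real.log B' + 21) (11 / 10 * εb) S' hq1 hq21 hθ hθ1 hη hεb hBβ hεBβ hηBβ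
    (by linarith) (by positivity) (by linarith) hS'0 hS'le hw1c (hb1c.div_const q) hb2c hm11c he11c
    h1 h2 h3 h4 h5 (fun σ hσ => (hLσ σ hσ).1) (by rw [ht00]; exact hw1ι) (by rw [ht00]; exact hM1ι)
  obtain ⟨kA, -⟩ := key
  -- the amplified seed is below `0.35 Y₁`
  have hamp : ∀ σ ∈ Icc 0 S', Real.exp (q ^ 5 * (5 * Real.log B' + 21)) *
      (11 / 10 * εb + 3 * εb * q ^ 2 * (B' + 1) ^ 2 * σ) ≤ 35 / 100 * Y₁ := by
    intro σ hσ
    refine (pulseBoot_amplification hB' hq5 hq0 hq2le hεb hσ.1 (hσ.2.trans hS'le) (by positivity)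
      le_rfl).trans ?_
    have h8 : (B' + 1) ^ 8 ≤ (bhi + 4) ^ 8 := pow_le_pow_left₀ (by linarith) hBβ4 8
    have := mul_le_mul_of_nonneg_left h8 (by positivity : 0 ≤ 35 / 100 * Real.exp 25 * εb)
    rw [hY₁]
    linarith
  have hbond : ∀ σ ∈ Icc 0 S', |wv (n + 1) (tι + σ / R n)| ≤ Y₁ ∧ M1 (n + 1) (tι + σ / R n) ≤ 1 := by
    intro σ hσ
    have hσ0 : 0 ≤ σ := hσ.1
    obtain ⟨k1, k2⟩ := kA σ hσ
    have ha := hamp σ hσ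
    refine ⟨k1.trans (by linarith), k2.trans ?_⟩
    have hq1' : q * (B' + 1) + 1 ≤ 12 / 10 * (bhi + 5) := by
      have : q * (B' + 1) ≤ 21 / 20 * (B' + 1) := mul_le_mul_of_nonneg_right hq21 (by linarith)
      linarith
    have h1 : (q * (B' + 1) + 1) * Real.exp (q ^ 5 * (5 * Real.log B' + 21)) *
        (11 / 10 * εb + 3 * εb * q ^ 2 * (B' + 1) ^ 2 * σ) ≤ 12 / 10 * (bhi + 5) * (35 / 100 * Y₁) := by
      rw [mul_assoc]
      exact mul_le_mul hq1' ha (by positivity) (by linarith)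
    have e : 12 / 10 * (bhi + 5) * (35 / 100 * Y₁) = 14 / 100 * (3 * Y₁ * (bhi + 5)) := by ring
    rw [e] at h1
    linarith
  -- the next carrier's majorant from its Duhamel restart inequality and the transfer budget
  have hlogle := pulse_log_le hB'
  have hM0σ : ∀ σ ∈ Icc 0 S', M0 (n + 1) (tι + σ / R n) ≤ 3 / 2 * B := by
    intro σ hσ
    have hσ0 : 0 ≤ σ := hσ.1
    have hsub : Icc 0 σ ⊆ Icc 0 S' := Icc_subset_Icc_right hσ.2
    have h := (hm01D σ hσ).2
    rw [hκ4, ht00] at h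
    set c : ℝ := 1 / 10 ^ 4 + 1 / 10 ^ 9 with hc
    have hGc : ContinuousOn (fun v => G0 (n + 1) (tι + v / R n)) (Icc 0 σ) := hg01c.mono hsub
    have hiW : IntervalIntegrable (fun v => (wv n (tι + v / R n)) ^ 2 / q ^ 3) volume 0 σ :=
      (((hwc.mono hsub).pow 2).div_const _).intervalIntegrable_of_Icc hσ.1
    have hiC : IntervalIntegrable (fun _ => c) volume 0 σ := intervalIntegrable_const
    have hI : ∫ v in (0 : ℝ)..σ, Real.exp (-(θ * q ^ 4 * (σ - v))) * |G0 (n + 1) (tι + v / R n)| ≤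
        ∫ v in (0 : ℝ)..σ, ((wv n (tι + v / R n)) ^ 2 / q ^ 3 + c) := by
      refine intervalIntegral.integral_mono_on hσ.1 ?_ (hiW.add hiC) fun v hv => ?_
      · exact ((Continuous.continuousOn (by fun_prop)).mul
          (continuous_abs.comp_continuousOn hGc)).intervalIntegrable_of_Icc (μ := volume) hσ.1
      · have hv' := hsub hv
        obtain ⟨-, l2, l3⟩ := hLσ v hv'
        have hex : Real.exp (-(θ * q ^ 4 * (σ - v))) ≤ 1 := Real.exp_le_one_iff.2 (by
          have : 0 ≤ θ * q ^ 4 * (σ - v) := mul_nonneg (by positivity) (by linarith [hv.2])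
          linarith)
        have hGabs : |G0 (n + 1) (tι + v / R n)| ≤ (wv n (tι + v / R n)) ^ 2 / q ^ 3 + c := by
          rw [hG0, hn1]
          have a1 : |(wv n (tι + v / R n)) ^ 2 / q ^ 3| ≤ (wv n (tι + v / R n)) ^ 2 / q ^ 3 :=
            (abs_of_nonneg (by positivity)).le
          have a2 : |(wv (n + 1) (tι + v / R n)) ^ 2| ≤ 1 / 10 ^ 4 := by
            rw [abs_of_nonneg (sq_nonneg _)]
            have h := pow_le_pow_left₀ (abs_nonneg _) l2 2
            rw [sq_abs] at h
            exact h.trans (by norm_num)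
          obtain ⟨-, a3⟩ := pulseBoot_abs_mul hεb l3 l2
          have a3' : |εb * bv (n + 1) (tι + v / R n) * wv (n + 1) (tι + v / R n)| ≤ 1 / 10 ^ 9 := by
            refine a3.trans ?_
            have e : εb * (3 * (bhi + 4)) * (1 / 100) = 3 / 100 * (εb * (bhi + 4)) := by ring
            rw [e]
            have : εb * (bhi + 4) ≤ εb * (bhi + 4) ^ 2 :=
              mul_le_mul_of_nonneg_left (le_self_pow₀ hbhi two_ne_zero) hεb.le
            linarith only [this, hεb2]
          obtain ⟨-, -, -, a4⟩ := pulseBoot_abs3 a1 a2 a3'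
          rw [hc]
          linarith
        calc Real.exp (-(θ * q ^ 4 * (σ - v))) * |G0 (n + 1) (tι + v / R n)|
            ≤ 1 * ((wv n (tι + v / R n)) ^ 2 / q ^ 3 + c) :=
              mul_le_mul hex hGabs (abs_nonneg _) zero_le_one
          _ = _ := one_mul _
    rw [intervalIntegral.integral_add hiW hiC, intervalIntegral.integral_const, smul_eq_mul, sub_zero,
      intervalIntegral.integral_div] at hI
    have hbud := hbudσ σ hσ
    have hI0 : 0 ≤ ∫ v in (0 : ℝ)..σ, (wv n (tι + v / R n)) ^ 2 :=
      intervalIntegral.integral_nonneg hσ.1 fun v _ => sq_nonneg _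
    -- `q⁴ (∫ w²/q³ + σ c) = q ∫ w² + q⁴ σ c`
    have e1 : q ^ 4 * ((∫ v in (0 : ℝ)..σ, (wv n (tι + v / R n)) ^ 2) / q ^ 3 + σ * c) =
        q * (∫ v in (0 : ℝ)..σ, (wv n (tι + v / R n)) ^ 2) + q ^ 4 * σ * c := by
      field_simp
    have h2 : q ^ 4 * ∫ v in (0 : ℝ)..σ, Real.exp (-(θ * q ^ 4 * (σ - v))) * |G0 (n + 1) (tι + v / R n)| ≤
        q * (∫ v in (0 : ℝ)..σ, (wv n (tι + v / R n)) ^ 2) + q ^ 4 * σ * c := by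
      rw [← e1]
      exact mul_le_mul_of_nonneg_left hI (by positivity)
    have h3 : q * (∫ v in (0 : ℝ)..σ, (wv n (tι + v / R n)) ^ 2) ≤
        21 / 20 * (B' + 6 * (B' / 10 ^ 4 + 33 / 4) + 23) :=
      mul_le_mul hq21 (by linarith) hI0 (by norm_num)
    have h4 : q ^ 4 * σ * c ≤ 111 / 100 * (1 / 10) * c :=
      mul_le_mul_of_nonneg_right (mul_le_mul hq4hi (hσ.2.trans hS'le) hσ.1 (by positivity))
        (by rw [hc]; norm_num)
    have hex : Real.exp (-(θ * q ^ 4 * σ)) ≤ 1 :=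
      Real.exp_le_one_iff.2 (by
        have : 0 ≤ θ * q ^ 4 * σ := by positivity
        linarith)
    obtain ⟨-, -, hM0nn, -⟩ := hmaj (n + 1) tι ⟨htι0, by linarith⟩
    have hM0e := mul_le_of_le_one_right hM0nn hex
    rw [hc] at h4
    linarith
  -- back to real time
  intro u hu
  have hσu : R n * (u - tι) ∈ Icc 0 S' :=
    ⟨mul_nonneg hRn.le (by linarith [hu.1]), mul_le_mul_of_nonneg_left (by linarith [hu.2]) hRn.le⟩
  have hut : tι + R n * (u - tι) / R n = u := htime1 u
  obtain ⟨a1, a2⟩ := hbond _ hσu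
  have a3 := hM0σ _ hσu
  rw [hut] at a1 a2 a3
  exact ⟨a1, a2, a3⟩


/-- **Registered tools sub-goal `stub_pulseBootLevel`** of the stub `pulseBoot` (line `Sketch`,
crux stmt-NavierStokesRegularity-1835): the amplification of the next bond over a truncated pulse
is polynomial, `e^{q⁵(5 log B' + 21)}(y₀ + 3ε̄q²(B'+1)²σ) ≤ 0.35 e^{25} ε̄ (B'+1)⁸`
(`pulseBoot_amplification`). [folklore] -/
theorem stub_pulseBootLevel :
    ∀ (q εb Bp σ y0 : ℝ), 10 ^ 4 ≤ Bp → q ^ 5 ≤ 116 / 100 → 0 < q → q ^ 2 ≤ 111 / 100 → 0 < εb →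
      0 ≤ σ → σ ≤ 1 / 10 → 0 ≤ y0 → y0 ≤ 11 / 10 * εb →
      Real.exp (q ^ 5 * (5 * Real.log Bp + 21)) * (y0 + 3 * εb * q ^ 2 * (Bp + 1) ^ 2 * σ) ≤
        35 / 100 * Real.exp 25 * εb * (Bp + 1) ^ 8 :=
  fun _ _ _ _ _ h1 h2 h3 h4 h5 h6 h7 h8 h9 => pulseBoot_amplification h1 h2 h3 h4 h5 h6 h7 h8 h9

end Summit.NavierStokesRegularity.NavierStokesRegularity.Theorems.PerpetualPumpAveragedTypeIBlowup

end
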